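import Mathlib
import Summits.Ventures.HodgeRepro.Tier4.Common.SettingOfData
import Summits.Ventures.HodgeRepro.Tier4.Line4.SuppMeasure

/-!
# Tier4/Line4/LevelTailInstance — C-L4-LEVELTAIL-INST (a)(b): the adelic instance of the support binders of the
level-measure assembly (`exists_fibreDominated_of_level_decay_count`, LevelTail p704492) on the level sets

Blind re-derivation cell `pub-hodge-repro`, Tier 4 «prove the step» (README §9–§10), seat t4-L2-p1 (gen 3; x2 g4's SEAT
CLOSE S15225 «the adelic instance of (c)'s support binders … unowned», taken S15227).  Tree path
`lean/Summits/Ventures/HodgeRepro/Tier4/Line4/LevelTailInstance.lean`.  Imports `Line4/SuppMeasure` (p704106: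
`suppSetFolded`, `suppMeasureFolded`), `Common/SettingOfData` (`Setting.ofAdelicData`: `T = torusT`,
`T′ = torusT'`, `DT = R.DT`, `μT = R.μT`).  Mathlib-level; no literature.

THE OBJECTS.  `levelSuppSet W γ₀ N γ := {(t, t′) ∈ T(𝔸) × T′(𝔸) : (t⁻¹ γ t′)_f ∈ K(N) γ₀,f K(N)}` — the level support set
WITHOUT the `D_T × D_T′` clause, so that it is CLOSED (the preimage of a compact under a continuous map) and MEASURABLE
outright; `suppSetFolded = levelSuppSet ∩ (D_T × D_T′)`, and against the restricted product measure
`(μ_T|_{D_T}) ⊗ (μ_{T′}|_{D_{T′}})` (the assembly's measure) `levelSuppSet` has measure exactly `suppMeasureFolded`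
(`Measure.prod_restrict`).

THE BINDERS OF THE ASSEMBLY, INSTANTIATED (`A N γ := levelSuppSet W γ₀ N γ`): `hAmeas` = `measurableSet_levelSuppSet`;
`hsuppA` = `mem_levelSuppSet_of_ne_zero` from the family's `suppFin`-shape (`F x ≠ 0 → x_f ∈ K(N) γ₀,f K(N)`); `hAv` = the
ℝ-bridge `le_ofReal_of_toReal_le` from a real bound on `suppMeasureFolded` (finite by `suppMeasureFolded_ne_top` under
`R.IsHaar`).  The real bound itself is C-L4-SUPPMEAS's ratio display in the unit `suppMeasure N γ₀`, off the transporter,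
plus C-L4-TRANSPORTER-SEP on the transporter — not here.

Nothing here says anything about the status of the Hodge conjecture for CM abelian varieties, which is NOT proved
(HC_CM is NOT proved by anyone in this repository).
-/

set_option autoImplicit false
noncomputable section
namespace Summit.Ventures.HodgeRepro.Tier4.Line4
open Summit.Ventures.HodgeRepro.Tier4 Summit.Ventures.HodgeRepro.Tier4.Common
  Summit.Ventures.HodgeRepro.Tier4.Line1 MeasureTheory
open scoped Topology Pointwise NNReal ENNReal

section LevelSuppSet
variable {k : Type} [Field k] [NumberField k] (W : PlaneData k)

/-- **The level support set on the torus pair**, without the fundamental-domain clause: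
`{(t, t′) : (t⁻¹ γ t′)_f ∈ K(N) γ₀,f K(N)}`. -/
def levelSuppSet (γ₀ : GA W) (N : ℕ) (γ : GA W) : Set (torusT W × torusT' W) :=
  {p | GA.ofFinPart W ((p.1 : GA W)⁻¹ * γ * (p.2 : GA W)) ∈ levelDoubleCoset W N (GA.ofFinPart W γ₀)}

/-- The level support set is closed (`N ≠ 0`). -/
theorem isClosed_levelSuppSet (γ₀ : GA W) {N : ℕ} (hN : N ≠ 0) (γ : GA W) :
    IsClosed (levelSuppSet W γ₀ N γ) := by
  haveI : T2Space (GA W) := t2Space_GA W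
  have hcont : Continuous fun p : torusT W × torusT' W => GA.ofFinPart W ((p.1 : GA W)⁻¹ * γ * (p.2 : GA W)) :=
    (continuous_ofFinPart W).comp (((continuous_subtype_val.comp continuous_fst).inv.mul continuous_const).mul
      (continuous_subtype_val.comp continuous_snd))
  exact (isCompact_levelDoubleCoset W hN _).isClosed.preimage hcont

/-- The level support set is measurable (`hAmeas`). -/
theorem measurableSet_levelSuppSet [MeasurableSpace (GA W)] [BorelSpace (GA W)] (γ₀ : GA W) {N : ℕ} (hN : N ≠ 0)
    (γ : GA W) : MeasurableSet (levelSuppSet W γ₀ N γ) := by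
  haveI := secondCountable_GA W
  haveI : BorelSpace (torusT W) := Subtype.borelSpace _
  haveI : BorelSpace (torusT' W) := Subtype.borelSpace _
  haveI : SecondCountableTopology (torusT W) := secondCountable_torusT W
  haveI : SecondCountableTopology (torusT' W) :=
    TopologicalSpace.Subtype.secondCountableTopology (torusT' W : Set (GA W))
  haveI : BorelSpace (torusT W × torusT' W) := Prod.borelSpace
  exact (isClosed_levelSuppSet W γ₀ hN γ).measurableSet

/-- `hsuppA`: a test function supported (at the finite places) in the double coset puts every non-zero twisted value
into the level support set. -/
theorem mem_levelSuppSet_of_ne_zero (γ₀ : GA W) (N : ℕ) {F : GA W → ℂ}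
    (hsupp : ∀ x, F x ≠ 0 → GA.ofFinPart W x ∈ levelDoubleCoset W N (GA.ofFinPart W γ₀))
    (γ : GA W) (t : torusT W) (t' : torusT' W) (h : F ((t : GA W)⁻¹ * γ * (t' : GA W)) ≠ 0) :
    (t, t') ∈ levelSuppSet W γ₀ N γ :=
  hsupp _ h

end LevelSuppSet

section Folded
variable {k : Type} [Field k] [NumberField k] (W : PlaneData k) [MeasurableSpace (GA W)] (R : RTFData W)

/-- The folded support set is the level support set cut down to `D_T × D_T′`. -/
theorem suppSetFolded_eq_inter (γ₀ : GA W) (N : ℕ) (γ : GA W) :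
    suppSetFolded W R γ₀ N γ = levelSuppSet W γ₀ N γ ∩ R.DT ×ˢ R.DT' := by
  ext p
  simp only [suppSetFolded, levelSuppSet, Set.mem_setOf_eq, Set.mem_inter_iff, Set.mem_prod]
  tauto

/-- Against the restricted product measure `(μ_T|_{D_T}) ⊗ (μ_{T′}|_{D_{T′}})` the level support set has measure
`suppMeasureFolded` (`hAv`'s left side is the folded unit). -/
theorem measure_restrict_prod_levelSuppSet [BorelSpace (GA W)] (hR : R.IsHaar) (γ₀ : GA W) {N : ℕ} (hN : N ≠ 0)
    (γ : GA W) :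
    ((R.μT.restrict R.DT).prod (R.μT'.restrict R.DT')) (levelSuppSet W γ₀ N γ) =
      suppMeasureFolded W R γ₀ N γ := by
  haveI : R.μT.IsHaarMeasure := hR.1
  haveI : R.μT'.IsHaarMeasure := hR.2.1
  haveI := secondCountable_GA W
  haveI : LocallyCompactSpace (torusT W) := locallyCompact_torusT W
  haveI : LocallyCompactSpace (torusT' W) := locallyCompactSpace_torusT' W
  haveI : SecondCountableTopology (torusT W) := secondCountable_torusT W
  haveI : SecondCountableTopology (torusT' W) :=
    TopologicalSpace.Subtype.secondCountableTopology (torusT' W : Set (GA W))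
  haveI : BorelSpace (torusT W) := Subtype.borelSpace _
  haveI : BorelSpace (torusT' W) := Subtype.borelSpace _
  haveI : IsLocallyFiniteMeasure R.μT := isLocallyFiniteMeasure_of_isFiniteMeasureOnCompacts
  haveI : IsLocallyFiniteMeasure R.μT' := isLocallyFiniteMeasure_of_isFiniteMeasureOnCompacts
  haveI : SigmaFinite R.μT := sigmaFinite_of_locallyFinite
  haveI : SigmaFinite R.μT' := sigmaFinite_of_locallyFinite
  rw [Measure.prod_restrict, Measure.restrict_apply (measurableSet_levelSuppSet W γ₀ hN γ),
    suppMeasureFolded, suppSetFolded_eq_inter]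

/-- The folded support measure is finite under `R.IsHaar` (the fundamental domains have finite measure). -/
theorem suppMeasureFolded_ne_top (hR : R.IsHaar) (γ₀ : GA W) (N : ℕ) (γ : GA W) :
    suppMeasureFolded W R γ₀ N γ ≠ ⊤ := by
  haveI : R.μT.IsHaarMeasure := hR.1
  haveI : R.μT'.IsHaarMeasure := hR.2.1
  haveI := secondCountable_GA W
  haveI : LocallyCompactSpace (torusT W) := locallyCompact_torusT W
  haveI : LocallyCompactSpace (torusT' W) := locallyCompactSpace_torusT' W
  haveI : SecondCountableTopology (torusT W) := secondCountable_torusT W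
  haveI : SecondCountableTopology (torusT' W) :=
    TopologicalSpace.Subtype.secondCountableTopology (torusT' W : Set (GA W))
  haveI : IsLocallyFiniteMeasure R.μT := isLocallyFiniteMeasure_of_isFiniteMeasureOnCompacts
  haveI : IsLocallyFiniteMeasure R.μT' := isLocallyFiniteMeasure_of_isFiniteMeasureOnCompacts
  haveI : SigmaFinite R.μT := sigmaFinite_of_locallyFinite
  haveI : SigmaFinite R.μT' := sigmaFinite_of_locallyFinite
  have hsub : suppSetFolded W R γ₀ N γ ⊆ R.DT ×ˢ R.DT' := by
    rintro p ⟨h1, h2, -⟩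
    exact ⟨h1, h2⟩
  refine ne_top_of_le_ne_top ?_ (measure_mono hsub)
  rw [Measure.prod_prod]
  exact ENNReal.mul_ne_top hR.2.2.2.1.ne hR.2.2.2.2.2.ne

end Folded

section Bridge

/-- **The `hAv` ℝ-bridge**: a real bound on a finite `ℝ≥0∞`-measure is a bound against `ENNReal.ofReal`. -/
theorem le_ofReal_of_toReal_le {x : ℝ≥0∞} (hx : x ≠ ⊤) {v : ℝ} (h : x.toReal ≤ v) : x ≤ ENNReal.ofReal v :=
  (ENNReal.le_ofReal_iff_toReal_le hx (le_trans ENNReal.toReal_nonneg h)).2 h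

end Bridge

end Summit.Ventures.HodgeRepro.Tier4.Line4

end
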